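/-
Origin: expansion seat `planner-pub-hodgecm-pv15-g2-0`, handover #2 2026-08-18T06:11:47Z (`HOME/pub-hodgecm-pv15-g2/lean/Pv15g2/UnfoldedPairing.lean`, md5 bcd3c4f6, 222 lines);
landed by the gen-6 packager in gate run 24 as `HodgeCM/Automorphic/UnfoldedPairing.lean` (import ^import Pv15g2\.→import HodgeCM.Automorphic. ×2).
-/
/-
Origin: HOME/pub-hodgecm-pv15-g2/lean/Pv15g2/UnfoldedPairing.lean — session planner-pub-hodgecm-pv15-g2-0
(unit pub-hodgecm-pv15-g2, DAG-NODE PROVER #15 gen 2; lineage N23a / AX12).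
Intended final place (packager's call): `HodgeCM/Automorphic/UnfoldedPairing.lean`; module renames
`Pv15g2.ThetaCarrierReg` ↦ `HodgeCM.Automorphic.ThetaCarrierReg`, `Pv15g2.BumpApprox` ↦
`HodgeCM.Automorphic.BumpApprox` (both mine, handed over before this file).
NEW, ADDITIVE; touches no existing file.

KIND: L2 (honest re-typing: two consequence-shaped hypotheses replaced by PerL's displayed identity) + KERNEL
(the two consequences derived) + L5 glue.  Nothing cited, nothing posited.
-/
import Summits.HodgeConjecture.HodgeCM.Automorphic.ThetaCarrierReg_2
import Summits.HodgeConjecture.HodgeCM.Automorphic.BumpApprox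
import Summits.HodgeConjecture.HodgeCM.PerL34.P36_unfolding

set_option autoImplicit false

/-!
# The unfolded pairing `𝒯_Φ(E^χ_f) = ∫ f(h) ϑ_{T,χ}(ω(h)Φ) dh` as THE torus-side input

In the carrier records (gen 2 `TorusCarrier.Analytic`, gen 3 `RepTorusCarrier.Analytic`, this seat's
`RegTorusCarrier.Analytic`) two of the torus-side hypotheses are CONSEQUENCE-shaped renderings of one displayed
identity of PerL v5 (Prop 3.6 Step 1, tex ll. 414–416):

  `𝒯_Φ(E^χ_f) = ∫_{U(W)(𝔸)} f(h) ϑ_{T,χ}(ω(h)Φ) dh`                                              (U)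

namely `AX12_unfold_lift` ("`𝒯_Φ(E^χ_f)` lies in the closed span of the `ϑ_{T,χ}(ω(h)Φ)`", ll. 419–421: "a Bochner
integral of a compactly supported continuous `S₁₂`-valued function lies in the closed subspace") and `AX12_molly`
("`ϑ_{T,χ}(Φ)` is an `L²`-limit of `𝒯_Φ(E^χ_{f_n})` for an approximate identity `f_n`", Thm 3.7, ll. 453–455).
The expansion seat pv14 (run 19, `HodgeCM.PerL34.P36_unfolding`) already typed (U) (`Step1Data.UnfoldingIdentity`)
and KERNEL-derived the first consequence in Mathlib generality (`integral_smul_mem_topologicalClosure_span`).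

This file puts (U) INTO THE CARRIER RECORD and derives BOTH consequences:
* `RegCoreCarrier.AnalyticU = {discreteDecomp, hatτ_complete, omg_one}` — the core hypotheses plus the unit law
  `ω(1) = id` of the Weil representation (structural);
* `RegTorusCarrier.AnalyticU μG = {AX5b_ϑ_cont, AX12_transl_cont, AX12_unfold, AX8_annihilation}` — (U) as the
  field `AX12_unfold`, over a measure `μG` on `G = U(W)(𝔸)` (Haar measure in the model; only "finite on compacts"
  and "positive on opens" are used);
* `RegTorusCarrier.AnalyticU.toAnalytic` — KERNEL: `AX12_unfold_lift` by pv14's closed-span lemma, `AX12_molly` by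
  the approximate identity (`BumpApprox.mem_closure_range_integral_smul`: bumps of mass one concentrating at
  `1 ∈ G`, continuity of `h ↦ ϑ_{T,χ}(ω(h)Φ)` = the field `AX12_transl_cont`, and `ω(1)Φ = Φ`);
* universe level `Universe.RegThetaCarrier.AnalyticU` ⟶ `Analytic`, and the END STATE over it.

Count: 3 + 4 + 4 = 11 named propositions per seesaw context (one of them the unit law `ω(1) = id`), against 12 in
`ThetaCarrierReg`, 15 in gen 3, 20 in gen 2.  What is new is not the count but the SHAPE: the torus side now carries
PerL's identity (U) itself rather than two of its consequences.

Honesty ledger.  (U) is an INTERNAL DERIVATION of PerL (Fubini over `T(L₀)\U(W)(𝔸) → T(𝔸)\U(W)(𝔸)`, the law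
`Ξ^χ_f(ty) = χ(t)Ξ^χ_f(y)`, `θ_Φ(g,th) = θ_{ω(h)Φ}(g,t)`); it stays a HYPOTHESIS here, exactly as in pv14's file —
about the carrier's abstract `TΦc`, `ϑc`, `omg` and this seat's DEFINED `E` (the pseudo-Eisenstein vector in
`L²(G ⧸ Γ)`).  PerL is not citable; the published anchor for seesaw unfolding is the carver's N23 row (unchanged).
-/

noncomputable section

open MeasureTheory
open scoped InnerProductSpace CompactlySupported

namespace HodgeCM

/-! ## 1. Core: the unit law of `ω` -/

namespace RegCoreCarrier

variable {G : Type} [Group G] [TopologicalSpace G] [IsTopologicalGroup G] [MeasurableSpace G] [BorelSpace G]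
variable {Γ : Subgroup G} [MeasurableSpace (G ⧸ Γ)] [BorelSpace (G ⧸ Γ)]
variable {μQ : Measure (G ⧸ Γ)} [SMulInvariantMeasure G (G ⧸ Γ) μQ]
variable {HG CG SK SigIdxG : Type}
variable [NormedAddCommGroup HG] [InnerProductSpace ℂ HG] [CompleteSpace HG]
variable [NormedAddCommGroup CG] [NormedSpace ℂ CG] [TopologicalSpace SK]
variable (C : RegCoreCarrier G Γ μQ HG CG SK SigIdxG)

/-- **Core hypotheses, (U)-version**: `RegCoreCarrier.Analytic` plus the unit law of the Weil representation on
`𝒮^κ` (structural: `ω` is a representation of `U(W)(𝔸)`, PerL §2). -/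
structure AnalyticU : Prop where
  /-- [GGPS] discrete decomposition of `L²([U(W)])` under the regular representation (PerL ll. 384–385) -/
  discreteDecomp : (⨆ V : RepDecomp.Irr C.toRepCoreCarrier.R,
    (V.1 : Submodule ℂ (Lp ℂ 2 μQ))).topologicalClosure = ⊤
  /-- AX1b(a): completeness of the `G_U`-side decomposition -/
  hatτ_complete : (⨆ j, C.hatτ j).topologicalClosure = ⊤
  /-- (structural) `ω(1) = id` on `𝒮^κ` -/
  omg_one : ∀ Φ : SK, C.omg 1 Φ = Φ

variable {C}

/-- (Ported verbatim from the HodgeCMPerL package; no docstring in the source.) -/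
theorem AnalyticU.toAnalytic (h : C.AnalyticU) : C.Analytic where
  discreteDecomp := h.discreteDecomp
  hatτ_complete := h.hatτ_complete

end RegCoreCarrier

/-! ## 2. Torus side: (U) as the input; `AX12_unfold_lift` and `AX12_molly` derived -/

namespace RegTorusCarrier

variable {G : Type} [Group G] [TopologicalSpace G] [IsTopologicalGroup G] [T2Space G] [LocallyCompactSpace G]
  [MeasurableSpace G] [BorelSpace G]
variable {Γ : Subgroup G} [DiscreteTopology Γ] [IsClosed (Γ : Set G)] [MeasurableSpace (G ⧸ Γ)] [BorelSpace (G ⧸ Γ)]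
variable {μQ : Measure (G ⧸ Γ)} [SMulInvariantMeasure G (G ⧸ Γ) μQ] [IsFiniteMeasureOnCompacts μQ]
variable {HG CG SK SigIdxG : Type}
variable [NormedAddCommGroup HG] [InnerProductSpace ℂ HG] [CompleteSpace HG]
variable [NormedAddCommGroup CG] [NormedSpace ℂ CG] [TopologicalSpace SK]
variable {C : RegCoreCarrier G Γ μQ HG CG SK SigIdxG}
variable {T : Type} [Group T] [TopologicalSpace T] [MeasurableSpace T] [OpensMeasurableSpace T]
variable (D : RegTorusCarrier C T) [IsFiniteMeasureOnCompacts D.ν]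

/-- **Torus-side hypotheses, (U)-version** over a measure `μG` on `U(W)(𝔸)` (Haar measure in the model):
PerL's unfolded pairing (U) replaces its two consequences `AX12_unfold_lift`, `AX12_molly`. -/
structure AnalyticU (μG : Measure G) : Prop where
  /-- AX5b: continuity of `Φ ↦ ϑ_{T,χ}(Φ)` -/
  AX5b_ϑ_cont : ∀ χ, Continuous (D.ϑc χ)
  /-- AX12: continuity of `h ↦ ϑ_{T,χ}(ω(h)Φ)` -/
  AX12_transl_cont : ∀ χ (Φ : SK), Continuous fun h : G => D.ϑc χ (C.omg h Φ)
  /-- **(U) the unfolded pairing** (PerL v5 Prop 3.6 Step 1, tex ll. 414–416, verbatim):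
  `𝒯_Φ(E^χ_f) = ∫_{U(W)(𝔸)} f(h) ϑ_{T,χ}(ω(h)Φ) dh`, an `L²([G_U])`-valued Bochner integral. -/
  AX12_unfold : ∀ (Φ : SK) χ (f : C_c(G, ℂ)),
    (C.toRepCoreCarrier.toCoreCarrier.TΦ Φ) (D.E χ f) =
      ∫ h, (f h : ℂ) • C.inclCG (D.ϑc χ (C.omg h Φ)) ∂μG
  /-- AX8 (composite): annihilation -/
  AX8_annihilation : ∀ v : Lp ℂ 2 μQ, (∀ χ f, ⟪D.E χ f, v⟫_ℂ = 0) →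
    D.toRepTorusCarrier.toTorusCarrier.Pw v = 0

variable {D}

/-- **The two consequence-shaped hypotheses are theorems of (U).**  `AX12_unfold_lift`: a Bochner integral lies in
the closed span of the integrand's values (pv14, `P36Unfolding.integral_smul_mem_topologicalClosure_span`);
`AX12_molly`: the approximate identity at `1 ∈ U(W)(𝔸)` (`BumpApprox.mem_closure_range_integral_smul`), using
the continuity `AX12_transl_cont` and `ω(1) = id`. -/
theorem AnalyticU.toAnalytic {μG : Measure G} [IsFiniteMeasureOnCompacts μG] [μG.IsOpenPosMeasure]
    (hD : D.AnalyticU μG) (hC : C.AnalyticU) : D.Analytic where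
  AX5b_ϑ_cont := hD.AX5b_ϑ_cont
  AX12_transl_cont := hD.AX12_transl_cont
  AX12_unfold_lift := fun Φ χ f => by
    rw [hD.AX12_unfold Φ χ f]
    exact PerL34.P36Unfolding.integral_smul_mem_topologicalClosure_span μG (fun h => (f h : ℂ)) _
  AX12_molly := fun χ Φ => by
    have hF : Continuous fun h : G => C.inclCG (D.ϑc χ (C.omg h Φ)) :=
      C.inclCG.continuous.comp (hD.AX12_transl_cont χ Φ)
    have h := BumpApprox.mem_closure_range_integral_smul μG hF 1
    have hr : (Set.range fun f : C_c(G, ℂ) => (C.toRepCoreCarrier.toCoreCarrier.TΦ Φ) (D.E χ f)) =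
        Set.range fun f : C_c(G, ℂ) => ∫ h, (f h : ℂ) • C.inclCG (D.ϑc χ (C.omg h Φ)) ∂μG := by
      congr 1
      funext f
      exact hD.AX12_unfold Φ χ f
    rw [hr]
    simpa only [hC.omg_one] using h
  AX8_annihilation := hD.AX8_annihilation

end RegTorusCarrier

/-! ## 3. Universe level and the END STATE -/

namespace Universe

open HodgeCM.Prior.Perl34File HodgeCM.Prior.Perl34File.Perl34

namespace RegThetaCarrier

variable {U : Universe} (D : U.RegThetaCarrier)

/-- **The (U)-version of the analytic hypotheses of a regular-model carrier**, over a family of measures `μG` on the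
groups `U(W)(𝔸)` of the contexts: 3 + 4 + 4 = 11 named propositions per context. -/
structure AnalyticU (μG : ∀ {L : CMField} {ι₁ : L →+* ℂ} (V : HermSpace3 L ι₁) (c : SeesawCtx L),
    Measure (D.G V c)) : Prop where
  core : ∀ {L : CMField} {ι₁ : L →+* ℂ} (V : HermSpace3 L ι₁) (c : SeesawCtx L), (D.core V c).AnalyticU
  t12 : ∀ {L : CMField} {ι₁ : L →+* ℂ} (V : HermSpace3 L ι₁) (c : SeesawCtx L), (D.t12 V c).AnalyticU (μG V c)
  t34 : ∀ {L : CMField} {ι₁ : L →+* ℂ} (V : HermSpace3 L ι₁) (c : SeesawCtx L), (D.t34 V c).AnalyticU (μG V c)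

variable {D}

/-- eleven ⟹ twelve (`AX12_unfold_lift`, `AX12_molly` derived on both torus sides). -/
theorem AnalyticU.toAnalytic
    {μG : ∀ {L : CMField} {ι₁ : L →+* ℂ} (V : HermSpace3 L ι₁) (c : SeesawCtx L), Measure (D.G V c)}
    [hμ₁ : ∀ {L : CMField} {ι₁ : L →+* ℂ} (V : HermSpace3 L ι₁) (c : SeesawCtx L),
      IsFiniteMeasureOnCompacts (μG V c)]
    [hμ₂ : ∀ {L : CMField} {ι₁ : L →+* ℂ} (V : HermSpace3 L ι₁) (c : SeesawCtx L),
      (μG V c).IsOpenPosMeasure]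
    (hA : D.AnalyticU μG) : D.Analytic where
  core := fun V c => (hA.core V c).toAnalytic
  t12 := fun V c => (hA.t12 V c).toAnalytic (hA.core V c)
  t34 := fun V c => (hA.t34 V c).toAnalytic (hA.core V c)

end RegThetaCarrier

end Universe

namespace Assembly

open HodgeCM.Prior.Perl34File HodgeCM.Prior.Perl34File.Perl34
open HodgeCM.Universe (RegThetaCarrier ThetaModel)

variable (U : Universe)

/-- **PerL over a regular-model carrier with the unfolded pairing (U) as input.** -/
theorem perL_ofRegCarrierU (M : U.ModelAxioms) (D : U.RegThetaCarrier)
    {μG : ∀ {L : CMField} {ι₁ : L →+* ℂ} (V : HermSpace3 L ι₁) (c : SeesawCtx L), Measure (D.G V c)}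
    [hμ₁ : ∀ {L : CMField} {ι₁ : L →+* ℂ} (V : HermSpace3 L ι₁) (c : SeesawCtx L),
      IsFiniteMeasureOnCompacts (μG V c)]
    [hμ₂ : ∀ {L : CMField} {ι₁ : L →+* ℂ} (V : HermSpace3 L ι₁) (c : SeesawCtx L),
      (μG V c).IsOpenPosMeasure]
    (hA : D.AnalyticU μG) (A : (ThetaModel.ofRegCarrier D hA.toAnalytic).Inputs)
    (hHR : U.Fact_hodgeRiemann20) : U.PerL :=
  perL_ofRegCarrier U M D hA.toAnalytic A hHR

/-- **COR-CM, END STATE over a regular-model carrier with (U) as input**: eleven named analytic propositions per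
seesaw context (one the unit law of `ω`), the model facts, the ten theta inputs, Hodge–Riemann, the QW8 facts. -/
theorem COR_CM_endState_ofRegCarrierU (M : U.ModelAxioms) (h29 : U.Fact_weightSpan) (h30 : U.Fact_weightHodge)
    (hE : U.Qw8ExtProd) (hD : U.Qw8DualPushPull) (hMi : U.Qw8Milne) (D : U.RegThetaCarrier)
    {μG : ∀ {L : CMField} {ι₁ : L →+* ℂ} (V : HermSpace3 L ι₁) (c : SeesawCtx L), Measure (D.G V c)}
    [hμ₁ : ∀ {L : CMField} {ι₁ : L →+* ℂ} (V : HermSpace3 L ι₁) (c : SeesawCtx L),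
      IsFiniteMeasureOnCompacts (μG V c)]
    [hμ₂ : ∀ {L : CMField} {ι₁ : L →+* ℂ} (V : HermSpace3 L ι₁) (c : SeesawCtx L),
      (μG V c).IsOpenPosMeasure]
    (hA : D.AnalyticU μG) (A : (ThetaModel.ofRegCarrier D hA.toAnalytic).Inputs)
    (hHR : U.Fact_hodgeRiemann20) : U.HC_CM :=
  COR_CM_endState_ofRegCarrier U M h29 h30 hE hD hMi D hA.toAnalytic A hHR

end Assembly

end HodgeCM

end
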